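import Summits.ValiantsHypothesis.ValiantsHypothesis.Theorems.LacunarySymmetroidMatrixDescartesDoorA26WallBubblingBubblingTwistedRolle

/-!
# Extended real exponential sums: the LAGUERRE–PÓLYA count `#zeros ≤ Σ_w (deg P_w + 1) − 1` — line `wall_bubbling`, W4 (file 2)

Helper for the line `Cruxes/DoorA26/Lines/wall_bubbling.lean` (stmt-ValiantsHypothesis-19979), obligations (W) `Stmt.stub_weylFaces` («format drop to
`(2,5)` plus CONFLUENT terms `x^E log x`», i.e. `t·e^{Et}` in the logarithmic variable) and (M) `Stmt.stub_mixedWalls` (the confluent slot of the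
blown-up cluster); seat val-sym-lift-p1 (g19), W4 of the re-point roster (desk R2664 / director R260), `--supports stmt-ValiantsHypothesis-19979
--as helper`.  An EXTENDED exponential sum is `t ↦ Σ_{w ∈ F} P_w(t)·e^{wt}` with real polynomial coefficients (`F : Finset ℝ`, `P : ℝ → ℝ[X]`,
written inline — no definition).  Proved here (distinct zeros, no multiplicities; Mathlib-only + the chain's `rolle_count`):
* `hasDerivAt_extSum_twist` — `d/dt Σ_w P_w(t)e^{(w−v)t} = Σ_w (P_w′ + (w−v)P_w)(t)e^{(w−v)t}`;
* `natDegree_derivative_add_C_mul` — for `c ≠ 0`, `P ≠ 0`: `P′ + c·P ≠ 0` with the same `natDegree`; `slots_derivative_lt` — the slot count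
  `(deg P + 1)` strictly drops under `P ↦ P′`;
* **`extSum_card_zeros_le`** — if some `P_w ≠ 0` then every finite set of zeros of `Σ_w P_w(t)e^{wt}` has at most
  `Σ_{w ∈ F, P_w ≠ 0} (natDegree P_w + 1) − 1` elements (induction on the slot count: twist at an active exponent, differentiate once, Rolle;
  a single active class is a polynomial times an exponential).  The pure case (`deg P_w = 0`) is the chain's B2 `zeros_le_distinct_exponents_sub_one`;
  each confluent slot `t^j e^{wt}` costs exactly one zero.
HONEST FRAMING.  Classical real analysis [folklore: Laguerre 1898; Pólya–Szegő V §75; Braess 1986 VI.1]; a counting TOOL for the limiting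
extended sums at Weyl faces / blown-up clusters; (W), (M) remain OPEN; nothing here bears on `DoorA26`, `MatrixDescartes` (stmt-18050) or VP ≠ VNP.
No definitions.
-/

-- `Summit.ValiantsHypothesis.ValiantsHypothesis.…` repeats a component by the D-0017 layout (single-conjunct summit); the name is mandated.
set_option linter.dupNamespace false
set_option autoImplicit false

namespace Summit.ValiantsHypothesis.ValiantsHypothesis.Theorems.LacunarySymmetroidMatrixDescartes.WallBubbling.Bubbling

open Finset Filter Topology Polynomial

/-! ## 1. Twisted derivative of an extended sum -/

/-- derivative of one confluent term: `d/dt [P(t)e^{ut}] = (P′ + uP)(t)e^{ut}`. [folklore] -/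
theorem hasDerivAt_poly_mul_exp (P : ℝ[X]) (u t : ℝ) :
    HasDerivAt (fun s => P.eval s * Real.exp (u * s)) ((derivative P + C u * P).eval t * Real.exp (u * t)) t := by
  have h1 : HasDerivAt (fun s => P.eval s) ((derivative P).eval t) t := P.hasDerivAt t
  have h2 : HasDerivAt (fun s => Real.exp (u * s)) (Real.exp (u * t) * u) t := by
    have := ((hasDerivAt_id' t).const_mul u).exp
    simpa using this
  refine (h1.mul h2).congr_deriv ?_
  rw [eval_add, eval_mul, eval_C]
  ring

/-- **twisted derivative of an extended sum**: `d/dt Σ_w P_w(t)e^{(w−v)t} = Σ_w (P_w′ + (w−v)P_w)(t)·e^{(w−v)t}`. [folklore] -/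
theorem hasDerivAt_extSum_twist (F : Finset ℝ) (P : ℝ → ℝ[X]) (v t : ℝ) :
    HasDerivAt (fun s => ∑ w ∈ F, (P w).eval s * Real.exp ((w - v) * s))
      (∑ w ∈ F, (derivative (P w) + C (w - v) * P w).eval t * Real.exp ((w - v) * t)) t := by
  have h := HasDerivAt.fun_sum (u := F) (A := fun w s => (P w).eval s * Real.exp ((w - v) * s))
    (A' := fun w => (derivative (P w) + C (w - v) * P w).eval t * Real.exp ((w - v) * t)) (x := t)
    (fun w _ => hasDerivAt_poly_mul_exp (P w) (w - v) t)
  exact h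

/-! ## 2. Slot bookkeeping -/

/-- `P′ + c·P` for `c ≠ 0`, `P ≠ 0`: non-zero with the same `natDegree`. [folklore] -/
theorem natDegree_derivative_add_C_mul (P : ℝ[X]) (hP : P ≠ 0) (c : ℝ) (hc : c ≠ 0) :
    derivative P + C c * P ≠ 0 ∧ (derivative P + C c * P).natDegree = P.natDegree := by
  have hcP : (C c * P).natDegree = P.natDegree := natDegree_C_mul hc
  have hcP0 : C c * P ≠ 0 := mul_ne_zero (C_ne_zero.2 hc) hP
  by_cases hd : P.natDegree = 0
  · -- constant `P`: derivative vanishes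
    obtain ⟨r, hr⟩ := natDegree_eq_zero.1 hd
    have hder : derivative P = 0 := by rw [← hr, derivative_C]
    rw [hder, zero_add]
    exact ⟨hcP0, hcP⟩
  · have hlt : (derivative P).natDegree < (C c * P).natDegree := by
      rw [hcP]; exact natDegree_derivative_lt hd
    have hdeg : (derivative P + C c * P).natDegree = P.natDegree := by
      rw [natDegree_add_eq_right_of_natDegree_lt hlt, hcP]
    refine ⟨fun h0 => ?_, hdeg⟩
    have := congrArg natDegree h0
    rw [hdeg, natDegree_zero] at this
    exact hd this

/-- the slot count drops under differentiation: `[P′ ≠ 0](deg P′ + 1) + 1 ≤ [P ≠ 0](deg P + 1)` for `P ≠ 0`. [folklore] -/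
theorem slots_derivative_lt (P : ℝ[X]) :
    (if derivative P = 0 then 0 else (derivative P).natDegree + 1) + 1 ≤ P.natDegree + 1 := by
  split_ifs with h
  · omega
  · have hd : P.natDegree ≠ 0 := by
      intro hd
      obtain ⟨r, hr⟩ := natDegree_eq_zero.1 hd
      exact h (by rw [← hr, derivative_C])
    have := natDegree_derivative_lt hd
    omega

/-! ## 3. The Laguerre–Pólya count -/

/-- zeros of `Σ P_w(t)e^{wt}` are zeros of the twisted sum `Σ P_w(t)e^{(w−v)t}`. [bookkeeping] -/
theorem extSum_twist_eq (F : Finset ℝ) (P : ℝ → ℝ[X]) (v t : ℝ) :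
    ∑ w ∈ F, (P w).eval t * Real.exp ((w - v) * t) = Real.exp (-(v * t)) * ∑ w ∈ F, (P w).eval t * Real.exp (w * t) := by
  rw [Finset.mul_sum]
  refine Finset.sum_congr rfl fun w _ => ?_
  rw [sub_mul, Real.exp_sub, Real.exp_neg]
  ring

/-- **LAGUERRE–PÓLYA COUNT FOR EXTENDED EXPONENTIAL SUMS.**  `F` a finite set of real exponents, `P_w` real polynomials, some `P_w ≠ 0`
(`w ∈ F`).  If the slot count satisfies `Σ_{w∈F} [P_w ≠ 0]·(natDegree P_w + 1) ≤ N + 1`, then every finite set of real zeros of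
`t ↦ Σ_{w∈F} P_w(t)e^{wt}` has at most `N` elements. [folklore: Laguerre; Pólya–Szegő V §75] -/
theorem extSum_card_zeros_le (N : ℕ) :
    ∀ (F : Finset ℝ) (P : ℝ → ℝ[X]), (∃ w ∈ F, P w ≠ 0) →
      (∑ w ∈ F, if P w = 0 then 0 else (P w).natDegree + 1) ≤ N + 1 →
      ∀ Z : Finset ℝ, (∀ z ∈ Z, ∑ w ∈ F, (P w).eval z * Real.exp (w * z) = 0) → Z.card ≤ N := by
  classical
  induction N with
  | zero =>
    intro F P hne hslots Z hZ
    obtain ⟨w₁, hw₁F, hw₁⟩ := hne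
    -- the single active slot is a non-zero constant: no zeros
    have hsingle : ∑ w ∈ F, (if P w = 0 then 0 else (P w).natDegree + 1) =
        (if P w₁ = 0 then 0 else (P w₁).natDegree + 1) + ∑ w ∈ F.erase w₁, (if P w = 0 then 0 else (P w).natDegree + 1) :=
      (Finset.add_sum_erase F _ hw₁F).symm
    rw [hsingle, if_neg hw₁] at hslots
    have hdeg : (P w₁).natDegree = 0 := by omega
    have hrest : ∀ w ∈ F.erase w₁, P w = 0 := by
      intro w hw
      by_contra h
      have h1 : (if P w = 0 then 0 else (P w).natDegree + 1) ≤ ∑ w ∈ F.erase w₁, (if P w = 0 then 0 else (P w).natDegree + 1) :=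
        Finset.single_le_sum (f := fun w => if P w = 0 then 0 else (P w).natDegree + 1) (fun _ _ => Nat.zero_le _) hw
      rw [if_neg h] at h1
      omega
    obtain ⟨r, hr⟩ := natDegree_eq_zero.1 hdeg
    have hr0 : r ≠ 0 := by rintro rfl; exact hw₁ (by rw [← hr, C_0])
    rw [Nat.le_zero, Finset.card_eq_zero, Finset.eq_empty_iff_forall_notMem]
    intro z hz
    have h0 := hZ z hz
    rw [← Finset.add_sum_erase F _ hw₁F, Finset.sum_eq_zero (fun w hw => by rw [hrest w hw, eval_zero, zero_mul]), add_zero,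
      ← hr, eval_C] at h0
    exact (mul_ne_zero hr0 (Real.exp_pos _).ne') h0
  | succ N ih =>
    intro F P hne hslots Z hZ
    obtain ⟨w₁, hw₁F, hw₁⟩ := hne
    by_cases hA : ∀ w ∈ F, w ≠ w₁ → P w = 0
    · -- single active class: zeros of `P_{w₁}(t)e^{w₁t}` are roots of `P_{w₁}`
      have hsingle : ∑ w ∈ F, (if P w = 0 then 0 else (P w).natDegree + 1) =
          (if P w₁ = 0 then 0 else (P w₁).natDegree + 1) + ∑ w ∈ F.erase w₁, (if P w = 0 then 0 else (P w).natDegree + 1) :=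
        (Finset.add_sum_erase F _ hw₁F).symm
      rw [hsingle, if_neg hw₁] at hslots
      have hsub : Z ⊆ (P w₁).roots.toFinset := by
        intro z hz
        have h0 := hZ z hz
        rw [← Finset.add_sum_erase F _ hw₁F,
          Finset.sum_eq_zero (fun w hw => by rw [hA w (Finset.mem_of_mem_erase hw) (Finset.ne_of_mem_erase hw), eval_zero, zero_mul]),
          add_zero] at h0
        rw [Multiset.mem_toFinset, mem_roots hw₁, IsRoot.def]
        exact (mul_eq_zero.1 h0).resolve_right (Real.exp_pos _).ne'
      calc Z.card ≤ (P w₁).roots.toFinset.card := Finset.card_le_card hsub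
        _ ≤ Multiset.card (P w₁).roots := Multiset.toFinset_card_le _
        _ ≤ (P w₁).natDegree := card_roots' _
        _ ≤ N + 1 := by omega
    · -- a second active class: twist at `w₁`, differentiate once, Rolle, induction
      push Not at hA
      obtain ⟨w₂, hw₂F, hw₂1, hw₂⟩ := hA
      -- the differentiated data, indexed by the shifted exponents `u = w − w₁`
      set F' : Finset ℝ := F.image (fun w => w - w₁) with hF'
      set Q : ℝ → ℝ[X] := fun u => derivative (P (u + w₁)) + C u * P (u + w₁) with hQ
      have hinj : Set.InjOn (fun w => w - w₁) F := fun a _ b _ h => by simpa using h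
      -- zeros of the original sum are zeros of the twisted sum, whose derivative is the `Q`-sum
      have hderiv : ∀ t, HasDerivAt (fun s => ∑ w ∈ F, (P w).eval s * Real.exp ((w - w₁) * s))
          (∑ u ∈ F', (Q u).eval t * Real.exp (u * t)) t := by
        intro t
        have h := hasDerivAt_extSum_twist F P w₁ t
        rw [hF', Finset.sum_image hinj]
        convert h using 2
        simp only [hQ, sub_add_cancel]
      -- a window containing `Z`
      set R : ℝ := ∑ z ∈ Z, |z| with hR
      have hZin : ∀ z ∈ Z, z ∈ Set.Icc (-R) R := by
        intro z hz
        have h1 : |z| ≤ R := Finset.single_le_sum (fun y _ => abs_nonneg y) hz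
        rw [Set.mem_Icc]; constructor <;> linarith [le_abs_self z, neg_abs_le z]
      have hZ1 : ∀ z ∈ Z, z ∈ Set.Icc (-R) R ∧ (fun s => ∑ w ∈ F, (P w).eval s * Real.exp ((w - w₁) * s)) z = 0 := by
        intro z hz
        refine ⟨hZin z hz, ?_⟩
        simp only [extSum_twist_eq, hZ z hz, mul_zero]
      obtain ⟨Z', hcard, hZ'⟩ := rolle_count hderiv (-R) R Z hZ1
      -- slot count of the differentiated data
      have hQne : ∃ u ∈ F', Q u ≠ 0 := by
        refine ⟨w₂ - w₁, Finset.mem_image_of_mem _ hw₂F, ?_⟩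
        simp only [hQ, sub_add_cancel]
        exact (natDegree_derivative_add_C_mul (P w₂) hw₂ (w₂ - w₁) (sub_ne_zero.2 hw₂1)).1
      have hslots' : ∑ u ∈ F', (if Q u = 0 then 0 else (Q u).natDegree + 1) ≤ N + 1 := by
        rw [hF', Finset.sum_image hinj]
        simp only [hQ, sub_add_cancel]
        -- compare slot by slot: strict drop at `w₁`, no increase elsewhere
        have hle : ∀ w ∈ F, (if derivative (P w) + C (w - w₁) * P w = 0 then 0 else (derivative (P w) + C (w - w₁) * P w).natDegree + 1) ≤
            (if P w = 0 then 0 else (P w).natDegree + 1) := by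
          intro w _
          by_cases hPw : P w = 0
          · simp [hPw]
          · rw [if_neg hPw]
            by_cases hww : w = w₁
            · subst hww
              rw [sub_self, C_0, zero_mul, add_zero]
              have := slots_derivative_lt (P w)
              omega
            · obtain ⟨hne0, hdeg⟩ := natDegree_derivative_add_C_mul (P w) hPw (w - w₁) (sub_ne_zero.2 hww)
              rw [if_neg hne0, hdeg]
        have hstrict : (if derivative (P w₁) + C (w₁ - w₁) * P w₁ = 0 then 0 else (derivative (P w₁) + C (w₁ - w₁) * P w₁).natDegree + 1) + 1 ≤
            (if P w₁ = 0 then 0 else (P w₁).natDegree + 1) := by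
          rw [sub_self, C_0, zero_mul, add_zero, if_neg hw₁]
          exact slots_derivative_lt (P w₁)
        have h3 : ∑ w ∈ F.erase w₁, (if derivative (P w) + C (w - w₁) * P w = 0 then 0
            else (derivative (P w) + C (w - w₁) * P w).natDegree + 1) ≤
            ∑ w ∈ F.erase w₁, (if P w = 0 then 0 else (P w).natDegree + 1) :=
          Finset.sum_le_sum fun w hw => hle w (Finset.mem_of_mem_erase hw)
        rw [← Finset.add_sum_erase F _ hw₁F]
        rw [← Finset.add_sum_erase F _ hw₁F] at hslots
        omega
      have hih := ih F' Q hQne hslots' Z' (fun z hz => (hZ' z hz).2)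
      omega

end Summit.ValiantsHypothesis.ValiantsHypothesis.Theorems.LacunarySymmetroidMatrixDescartes.WallBubbling.Bubbling
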